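import Literature.NumberTheory.Automorphic.RankinSelbergTorusPairEuler
import HarnessLib

/-!
# Translating the unfolded Rankin–Selberg integral of a pair by a torus element

Topic `NumberTheory/Automorphic`; namespace `Literature.NumberTheory.Automorphic`. Theorems only.
For a torus element `τ = (τ_0, …, τ_{n-1}) ∈ (𝔸_Kˣ)ⁿ` with last entry `τ_{n-1} = 1` and Whittaker
functions `W`, `W'`, the substitution `a ↦ τ a` in the unfolded Rankin–Selberg integral of the pair
(`rankinSelbergTorusPairIntegralC`, the Bochner integral of
`I_s(a, k) = W(diag(a) k) W'(diag(a) k) Φ(e_n diag(a) k) |det a|^s δ_B(a)⁻¹` against `νA ⊗ νK` with `νA`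
left invariant) gives

  `Ψ(s; W, W', Φ) = w_s(τ) · Ψ(s; W(diag(τ) ·), W'(diag(τ) ·), Φ)`,  `w_s(τ) = |det τ|^s δ_B(τ)⁻¹`

(`rankinSelbergTorusPairIntegralC_eq_torusWeightC_mul_translate`): pointwise
`I_s(τ a, k) = w_s(τ) I^τ_s(a, k)` (`torusPairIntegrandC_translate`: `diag(τ a) k = diag(τ) diag(a) k`,
the weight is multiplicative, and `e_n diag(τ) = τ_{n-1} e_n = e_n` leaves `Φ(e_n ·)` unchanged), and the
map `(a, k) ↦ (τ a, k)` preserves `νA ⊗ νK`. Integrability transfers (`integrable_torusPairIntegrandC_translate`),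
the weight `w_s(τ)` is a nowhere-vanishing (`torusWeightC_ne_zero`) entire
(`differentiable_torusWeightC`, `RankinSelbergTorusHolomorphy`) function of `s`, and the modulus of a LEFT translate `g ↦ W(diag(τ) g)` is still invariant
under the centre when that of `W` is (`norm_translate_scalar_mul`). This is the change of variables by
which the unramified computation at a place where the additive character is not normalised is reduced
to the normalised one (Cogdell (2004), §3.1, Thm. 3.3: translate by
`diag(ϖ^{-e(n-1)}, …, ϖ^{-e}, 1)`), used for the places dividing the different `𝔡_K`.

## References

* J. W. Cogdell, *Analytic theory of L-functions for GL_n* (2004), §2.3 Thm. 2.2, §3.1 Thm. 3.3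
  [CogdellAnalyticTheory2004].
* H. Jacquet, J. A. Shalika, Amer. J. Math. 103 (1981), §2, §4 [JacquetShalikaAJM1981].
-/

noncomputable section

open MeasureTheory Measure NumberField IsDedekindDomain Matrix Set Filter Finset Topology
open scoped MatrixGroups ENNReal NNReal ComplexConjugate Pointwise
open Literature.NumberTheory.GaloisRepresentations (ideleGroup localUnits)

namespace Literature.NumberTheory.Automorphic

section Pointwise

variable {n : ℕ} {K : Type} [Field K] [NumberField K]
variable {W W' : GL (Fin n) (AdeleRing (𝓞 K) K) → ℂ} {Φ : (Fin n → AdeleRing (𝓞 K) K) → ℝ}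

/-- **The complex torus weight does not vanish** (`‖a_i‖ > 0`). [folklore] -/
theorem torusWeightC_ne_zero (s : ℂ) (a : Fin n → ideleGroup K) : torusWeightC n K s a ≠ 0 := by
  unfold torusWeightC
  refine Finset.prod_ne_zero_iff.2 fun i _ h => ?_
  rw [Complex.cpow_eq_zero_iff] at h
  exact (Complex.ofReal_ne_zero.2 (ideleNorm_coe_pos (K := K) (a i)).ne') h.1

/-- **The pair integrand at a translated torus point**: for `τ` with last entry `1`,
`I_s(τ a, k) = w_s(τ) · (W(diag τ ·) W'(diag τ ·))`-integrand at `(a, k)`. [folklore] -/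
theorem torusPairIntegrandC_translate (τ : Fin n → ideleGroup K) (hτ : lastEntry τ = 1) (s : ℂ)
    (p : (Fin n → ideleGroup K) × ↥(maximalCompactAdelic n K)) :
    torusPairIntegrandC n K W W' Φ s (τ * p.1, p.2) =
      torusWeightC n K s τ * torusPairIntegrandC n K (fun g => W (glDiagonal n (AdeleRing (𝓞 K) K) τ * g))
        (fun g => W' (glDiagonal n (AdeleRing (𝓞 K) K) τ * g)) Φ s p := by
  obtain ⟨a, k⟩ := p
  simp only [torusPairIntegrandC]
  rw [torusPoint_mul, lastRow_glDiagonal_mul, hτ, Units.val_one, one_smul, torusWeightC_mul]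
  ring

/-- The modulus of a left translate by a torus element is central-invariant when that of `W` is. [folklore] -/
theorem norm_translate_scalar_mul (τ : Fin n → ideleGroup K)
    (hWZ : ∀ (z : ideleGroup K) (g : GL (Fin n) (AdeleRing (𝓞 K) K)),
      ‖W (Matrix.GeneralLinearGroup.scalar (Fin n) z * g)‖ = ‖W g‖)
    (z : ideleGroup K) (g : GL (Fin n) (AdeleRing (𝓞 K) K)) :
    ‖W (glDiagonal n (AdeleRing (𝓞 K) K) τ * (Matrix.GeneralLinearGroup.scalar (Fin n) z * g))‖ =
      ‖W (glDiagonal n (AdeleRing (𝓞 K) K) τ * g)‖ := by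
  have hcomm : glDiagonal n (AdeleRing (𝓞 K) K) τ * Matrix.GeneralLinearGroup.scalar (Fin n) z =
      Matrix.GeneralLinearGroup.scalar (Fin n) z * glDiagonal n (AdeleRing (𝓞 K) K) τ :=
    (Matrix.GeneralLinearGroup.scalar_commute z (glDiagonal n (AdeleRing (𝓞 K) K) τ)).symm
  rw [← mul_assoc, hcomm, mul_assoc, hWZ]

end Pointwise

section Integral

variable {n : ℕ} {K : Type} [Field K] [NumberField K]
variable [MeasurableSpace (ideleGroup K)] [BorelSpace (ideleGroup K)]

-- the house local instances of `RankinSelbergTorusPairEuler` (Borel structure of `GL_n(𝔸_K)`, second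
-- countability of `𝔸_Kˣ`); none overrides a Mathlib instance
attribute [local instance] adelicBorel borelSpace_adelic locallyCompactSpace_adelic
  secondCountableTopology_gl_adelic secondCountableTopology_ideleGroup

variable (νA : Measure (Fin n → ideleGroup K)) [νA.IsMulLeftInvariant] [SFinite νA]
  (νK : Measure ↥(maximalCompactAdelic n K)) [SFinite νK]
variable {W W' : GL (Fin n) (AdeleRing (𝓞 K) K) → ℂ} {Φ : (Fin n → AdeleRing (𝓞 K) K) → ℝ}

/-- The translation `(a, k) ↦ (τ a, k)` as a measure-preserving equivalence of `νA ⊗ νK`. [folklore] -/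
theorem measurePreserving_prodMap_mul_left (τ : Fin n → ideleGroup K) :
    MeasurePreserving (Prod.map (τ * ·) id :
      (Fin n → ideleGroup K) × ↥(maximalCompactAdelic n K) → (Fin n → ideleGroup K) × ↥(maximalCompactAdelic n K))
      (νA.prod νK) (νA.prod νK) :=
  (measurePreserving_mul_left νA τ).prod (MeasurePreserving.id νK)

/-- **Substituting `a ↦ τ a` in the unfolded Rankin–Selberg integral of a pair**: for `τ` with last
entry `1`, `Ψ(s; W, W', Φ) = w_s(τ) · Ψ(s; W(diag τ ·), W'(diag τ ·), Φ)` (left invariance of `νA`; no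
integrability needed, both sides being `0` otherwise). [cite: CogdellAnalyticTheory2004, §3.1, Thm. 3.3] -/
theorem rankinSelbergTorusPairIntegralC_eq_torusWeightC_mul_translate (τ : Fin n → ideleGroup K)
    (hτ : lastEntry τ = 1) (s : ℂ) :
    rankinSelbergTorusPairIntegralC n K νA νK W W' Φ s =
      torusWeightC n K s τ * rankinSelbergTorusPairIntegralC n K νA νK
        (fun g => W (glDiagonal n (AdeleRing (𝓞 K) K) τ * g))
        (fun g => W' (glDiagonal n (AdeleRing (𝓞 K) K) τ * g)) Φ s := by
  let e : (Fin n → ideleGroup K) × ↥(maximalCompactAdelic n K) ≃ᵐ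
      (Fin n → ideleGroup K) × ↥(maximalCompactAdelic n K) :=
    (MeasurableEquiv.mulLeft τ).prodCongr (MeasurableEquiv.refl _)
  have he : ⇑e = Prod.map (τ * ·) id := rfl
  have hmp : MeasurePreserving e (νA.prod νK) (νA.prod νK) := by
    rw [he]; exact measurePreserving_prodMap_mul_left νA νK τ
  unfold rankinSelbergTorusPairIntegralC
  calc ∫ p, torusPairIntegrandC n K W W' Φ s p ∂(νA.prod νK)
      = ∫ p, torusPairIntegrandC n K W W' Φ s (e p) ∂(νA.prod νK) :=
        (hmp.integral_comp e.measurableEmbedding _).symm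
    _ = ∫ p, torusWeightC n K s τ * torusPairIntegrandC n K (fun g => W (glDiagonal n (AdeleRing (𝓞 K) K) τ * g))
          (fun g => W' (glDiagonal n (AdeleRing (𝓞 K) K) τ * g)) Φ s p ∂(νA.prod νK) := by
        refine integral_congr_ae (Filter.Eventually.of_forall fun p => ?_)
        exact torusPairIntegrandC_translate τ hτ s p
    _ = _ := integral_const_mul _ _

/-- **Integrability transfers to the translated pair integrand.** [folklore] -/
theorem integrable_torusPairIntegrandC_translate (τ : Fin n → ideleGroup K) (hτ : lastEntry τ = 1) {s : ℂ}
    (hint : Integrable (torusPairIntegrandC n K W W' Φ s) (νA.prod νK)) :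
    Integrable (torusPairIntegrandC n K (fun g => W (glDiagonal n (AdeleRing (𝓞 K) K) τ * g))
      (fun g => W' (glDiagonal n (AdeleRing (𝓞 K) K) τ * g)) Φ s) (νA.prod νK) := by
  let e : (Fin n → ideleGroup K) × ↥(maximalCompactAdelic n K) ≃ᵐ
      (Fin n → ideleGroup K) × ↥(maximalCompactAdelic n K) :=
    (MeasurableEquiv.mulLeft τ).prodCongr (MeasurableEquiv.refl _)
  have he : ⇑e = Prod.map (τ * ·) id := rfl
  have hmp : MeasurePreserving e (νA.prod νK) (νA.prod νK) := by
    rw [he]; exact measurePreserving_prodMap_mul_left νA νK τ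
  have hcomp : Integrable (torusPairIntegrandC n K W W' Φ s ∘ e) (νA.prod νK) :=
    (hmp.integrable_comp_emb e.measurableEmbedding).2 hint
  have heq : (fun p => (torusWeightC n K s τ)⁻¹ * (torusPairIntegrandC n K W W' Φ s ∘ e) p) =
      torusPairIntegrandC n K (fun g => W (glDiagonal n (AdeleRing (𝓞 K) K) τ * g))
        (fun g => W' (glDiagonal n (AdeleRing (𝓞 K) K) τ * g)) Φ s := by
    funext p
    rw [Function.comp_apply, he, show Prod.map (τ * ·) id p = (τ * p.1, p.2) from rfl,
      torusPairIntegrandC_translate τ hτ s p, ← mul_assoc, inv_mul_cancel₀ (torusWeightC_ne_zero s τ), one_mul]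
  rw [← heq]
  exact hcomp.const_mul _

end Integral

end Literature.NumberTheory.Automorphic
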